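import Literature.ComputerArithmetic.Shewchuk1997.Orient2dStageA
import Literature.ComputerArithmetic.Shewchuk1997.FastExpansionSum
import Mathlib.Tactic.Linarith
import Mathlib.Tactic.Positivity
import Mathlib.Tactic.Ring
import Mathlib.Tactic.FieldSimp
import Mathlib.Tactic.NormNum

/-!
# Shewchuk 1997, §4.4: the floating-point filter of ORIENT3D (stage A) and its error bound

J. R. Shewchuk, *Adaptive precision floating-point arithmetic and fast robust geometric predicates*,
Discrete Comput. Geom. 18 (1997) 305–363, §4.4 "ORIENT3D, INCIRCLE, and INSPHERE", pp. 350–352: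
Fig. 22 p. 351 (the expression tree of ORIENT3D, determinant (7) of §4.2 p. 345 expanded along its
third column) and Table 3 p. 351 (error bounds; line A: `(7ε + 56ε²) ⊗ (α_a ⊕ α_b ⊕ α_c)` with
`α_a = |a_z ⊖ d_z| ⊗ (|(b_x ⊖ d_x) ⊗ (c_y ⊖ d_y)| ⊕ |(b_y ⊖ d_y) ⊗ (c_x ⊖ d_x)|)` and `α_b`, `α_c`
cyclically), and the public-domain `predicates.c` (function `orient3d`, constant
`o3derrboundA = (7.0 + 56.0 * epsilon) * epsilon`).

THE RESULT.  ORIENT3D(a, b, c, d) is the sign of the determinant (7),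
`|a−d; b−d; c−d| = (a_z−d_z)·((b_x−d_x)(c_y−d_y) − (c_x−d_x)(b_y−d_y))
 + (b_z−d_z)·((c_x−d_x)(a_y−d_y) − (a_x−d_x)(c_y−d_y))
 + (c_z−d_z)·((a_x−d_x)(b_y−d_y) − (b_x−d_x)(a_y−d_y))`.
Stage A evaluates this expression in ordinary floating point (Fig. 22: nine differences, six
products, three two-term minors, three products by the `z`-differences, two additions) to obtain the
approximation `A = det`, computes the "permanent" `α_a ⊕ α_b ⊕ α_c` of Table 3 and
`errbound = (7ε + 56ε²) ⊗ permanent`, and returns `det` if `|det| > errbound`; otherwise it falls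
through to the adaptive stages B–D (`orient3dadapt`).  Table 3, line A asserts that a `det` so
returned has the sign of the exact determinant.  The paper prints the bound without the derivation
("Error bounds for the largest component of each of these expansions are given in Table 3", p. 350);
the derivation is the three-dimensional analogue of the one printed for ORIENT2D on p. 348, and is
carried out here.

THIS FILE types stage A as the function `orient3dStageA fl K` (`some det` = the filter answers,
`none` = fall through) and proves `orient3dStageA_correct`: for `p ≥ 6`, ANY round-to-nearest `fl`
(any tie rule), `K = o3derrboundA p = (7 + 56ε)ε` (`ε = 2^−p`), and input coordinates in a format
`F(p, e₀)` coarse enough that no operation of stage A underflows inexactly (`emin ≤ e₀`,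
`emin + 2p ≤ 3e₀`; binary64: coordinates that are multiples of `2^−322`), whenever stage A returns
`det`, `det > 0 ↔ (7) > 0` and `det < 0 ↔ (7) < 0`.  The heart is the abstract inequality
`orient3d_stageA_sign_of_bounds`: with relative errors `ε` w.r.t. the COMPUTED values for the
differences, the six products and the last addition, and w.r.t. the true operands for the minors,
the three cofactor products, the first addition and the nine operations of the bound, one gets
`|(7) − det| ≤ ε|det| + (7ε + 9ε² + 5ε³ + ε⁴)·Π` and `errbound ≥ (1 − ε)⁵(7ε + 56ε²)·Π` for the
exact permanent `Π = Σ |x_z|(|P| + |P'|)` of the computed products, and the margin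
`(1 − ε)⁶(7 + 56ε)ε − (7ε + 9ε² + 5ε³ + ε⁴) = ε²(5 − 236ε + 699ε² − 1015ε³ + 798ε⁴ − 329ε⁵ + 56ε⁶)`
is positive for `0 < ε ≤ 1/64` — which is where `p ≥ 6` enters (the leading `7` of Shewchuk's
coefficient is exactly the first-order constant; the `56ε²` absorbs the higher-order terms and
the roundings — five deep — of the bound's own evaluation).  MODELLING NOTES: (i) Fig. 22 draws
the two three-term sums (of the cofactor terms, and of `α_a, α_b, α_c`) as single nodes; they are
typed here left-to-right, `(q_a ⊕ q_b) ⊕ q_c`, as C evaluates `predicates.c`'s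
`adz * (bdxcdy - cdxbdy) + bdz * (cdxady - adxcdy) + cdz * (adxbdy - bdxady)` and its `permanent`;
(ii) the acceptance test is typed strict, `errbound < det ∨ errbound < −det`, as in `predicates.c`
(`(det > errbound) || (-det > errbound)`); the non-strict test would be covered by the same margin;
(iii) overflow is not modelled (as everywhere in this library); (iv) Table 3 writes
`α_a = |x₁| ⊗ (|x₆| ⊕ |x₇|)`, `predicates.c` multiplies in the other order — the same operation.
-/

namespace Literature.ComputerArithmetic.Shewchuk1997

open Literature.ComputerArithmetic.JeannerodRump2018
open Literature.ComputerArithmetic.BoldoJeannerodMelquiondMuller2023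
open Literature.ComputerArithmetic.JeannerodLouvetMuller2013

variable {p : ℕ} {emin : ℤ} {fl : ℚ → ℚ}

/-! ## The error analysis of one cofactor term and of the whole determinant -/

/-- `u = 2^−p ≤ 1/64` for `p ≥ 6` (the precision range in which the stage-A coefficient
`7ε + 56ε²` of Table 3 dominates the accumulated error).
[cite: Shewchuk1997, §4.4 Table 3 p. 351] -/
theorem unitRoundoff_le_of_six_le (hp : 6 ≤ p) : unitRoundoff p ≤ 1 / 64 := by
  unfold unitRoundoff
  have h : (64 : ℚ) ≤ 2 ^ p := by
    calc (64 : ℚ) = 2 ^ 6 := by norm_num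
      _ ≤ 2 ^ p := pow_le_pow_right₀ (by norm_num) hp
  exact one_div_le_one_div_of_le (by norm_num) h

/-- **One cofactor term of Fig. 22** (the analogue of p. 348 one level up).  Let
`y_i = z_i ± ε|z_i|` (`i = 0..4`: the `z`-difference and the four factors of the minor, true vs
computed), `z₁z₂ = P₁ ± ε|P₁|`, `z₃z₄ = P₂ ± ε|P₂|` (computed products),
`P₁ − P₂ = M ± ε|P₁ − P₂|` (computed minor) and `z₀M = Q ± ε|z₀M|` (computed cofactor term).
Then, with `S = |P₁| + |P₂|`,
`|y₀(y₁y₂ − y₃y₄) − Q| ≤ (6ε + 7ε² + 4ε³ + ε⁴)·|z₀|S` and `|Q| ≤ (1 + ε)²·|z₀|S`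
(product step of p. 348 twice: `y₁y₂ − y₃y₄ = (P₁ − P₂) ± (3ε + 3ε² + ε³)S`; then one subtraction,
one factor `y₀ = z₀ ± ε|z₀|`, one multiplication).
[cite: Shewchuk1997, §4.3 p. 348; §4.4 Fig. 22 p. 351] -/
theorem cofactor_sub_le_of_rel {u y₀ y₁ y₂ y₃ y₄ z₀ z₁ z₂ z₃ z₄ P₁ P₂ M Q : ℚ} (hu : 0 ≤ u)
    (h₀ : |y₀ - z₀| ≤ u * |z₀|) (h₁ : |y₁ - z₁| ≤ u * |z₁|) (h₂ : |y₂ - z₂| ≤ u * |z₂|)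
    (h₃ : |y₃ - z₃| ≤ u * |z₃|) (h₄ : |y₄ - z₄| ≤ u * |z₄|)
    (hP₁ : |z₁ * z₂ - P₁| ≤ u * |P₁|) (hP₂ : |z₃ * z₄ - P₂| ≤ u * |P₂|)
    (hM : |(P₁ - P₂) - M| ≤ u * |P₁ - P₂|) (hQ : |z₀ * M - Q| ≤ u * |z₀ * M|) :
    |y₀ * (y₁ * y₂ - y₃ * y₄) - Q| ≤
        (6 * u + 7 * u ^ 2 + 4 * u ^ 3 + u ^ 4) * (|z₀| * (|P₁| + |P₂|)) ∧
      |Q| ≤ (1 + u) ^ 2 * (|z₀| * (|P₁| + |P₂|)) := by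
  have e₁ : |y₁ * y₂ - P₁| ≤ (3 * u + 3 * u ^ 2 + u ^ 3) * |P₁| :=
    abs_mul_sub_le_of_rel hu h₁ h₂ hP₁
  have e₂ : |y₃ * y₄ - P₂| ≤ (3 * u + 3 * u ^ 2 + u ^ 3) * |P₂| :=
    abs_mul_sub_le_of_rel hu h₃ h₄ hP₂
  have hz0 : 0 ≤ |z₀| := abs_nonneg _
  have hPP : |P₁ - P₂| ≤ |P₁| + |P₂| := abs_sub _ _
  -- the true minor against `P₁ − P₂` and against the computed minor `M`
  have hm1 : |(y₁ * y₂ - y₃ * y₄) - (P₁ - P₂)| ≤ (3 * u + 3 * u ^ 2 + u ^ 3) * (|P₁| + |P₂|) := by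
    have hdec : (y₁ * y₂ - y₃ * y₄) - (P₁ - P₂) = (y₁ * y₂ - P₁) - (y₃ * y₄ - P₂) := by ring
    rw [hdec]
    calc |(y₁ * y₂ - P₁) - (y₃ * y₄ - P₂)| ≤ |y₁ * y₂ - P₁| + |y₃ * y₄ - P₂| := abs_sub _ _
      _ ≤ (3 * u + 3 * u ^ 2 + u ^ 3) * |P₁| + (3 * u + 3 * u ^ 2 + u ^ 3) * |P₂| :=
          add_le_add e₁ e₂
      _ = (3 * u + 3 * u ^ 2 + u ^ 3) * (|P₁| + |P₂|) := by ring
  have hmM : |(y₁ * y₂ - y₃ * y₄) - M| ≤ (4 * u + 3 * u ^ 2 + u ^ 3) * (|P₁| + |P₂|) := by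
    have hdec : (y₁ * y₂ - y₃ * y₄) - M = ((y₁ * y₂ - y₃ * y₄) - (P₁ - P₂)) + ((P₁ - P₂) - M) := by
      ring
    rw [hdec]
    calc |((y₁ * y₂ - y₃ * y₄) - (P₁ - P₂)) + ((P₁ - P₂) - M)|
          ≤ |(y₁ * y₂ - y₃ * y₄) - (P₁ - P₂)| + |(P₁ - P₂) - M| := abs_add_le _ _
      _ ≤ (3 * u + 3 * u ^ 2 + u ^ 3) * (|P₁| + |P₂|) + u * (|P₁| + |P₂|) :=
          add_le_add hm1 (hM.trans (mul_le_mul_of_nonneg_left hPP hu))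
      _ = (4 * u + 3 * u ^ 2 + u ^ 3) * (|P₁| + |P₂|) := by ring
  have hm_abs : |y₁ * y₂ - y₃ * y₄| ≤ (1 + 3 * u + 3 * u ^ 2 + u ^ 3) * (|P₁| + |P₂|) := by
    have := abs_sub_abs_le_abs_sub (y₁ * y₂ - y₃ * y₄) (P₁ - P₂)
    linarith
  have hM_abs : |M| ≤ (1 + u) * (|P₁| + |P₂|) := by
    have h1 := abs_sub_abs_le_abs_sub M (P₁ - P₂)
    rw [abs_sub_comm M (P₁ - P₂)] at h1
    have h2 : u * |P₁ - P₂| ≤ u * (|P₁| + |P₂|) := mul_le_mul_of_nonneg_left hPP hu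
    linarith
  have hQ' : |z₀ * M - Q| ≤ u * (|z₀| * |M|) := by rw [← abs_mul]; exact hQ
  have hdec : y₀ * (y₁ * y₂ - y₃ * y₄) - Q =
      (y₀ - z₀) * (y₁ * y₂ - y₃ * y₄) + z₀ * ((y₁ * y₂ - y₃ * y₄) - M) + (z₀ * M - Q) := by ring
  constructor
  · rw [hdec]
    calc |(y₀ - z₀) * (y₁ * y₂ - y₃ * y₄) + z₀ * ((y₁ * y₂ - y₃ * y₄) - M) + (z₀ * M - Q)|
          ≤ |(y₀ - z₀) * (y₁ * y₂ - y₃ * y₄)| + |z₀ * ((y₁ * y₂ - y₃ * y₄) - M)| + |z₀ * M - Q| :=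
          abs_add_three _ _ _
      _ = |y₀ - z₀| * |y₁ * y₂ - y₃ * y₄| + |z₀| * |(y₁ * y₂ - y₃ * y₄) - M| + |z₀ * M - Q| := by
          rw [abs_mul, abs_mul]
      _ ≤ u * |z₀| * ((1 + 3 * u + 3 * u ^ 2 + u ^ 3) * (|P₁| + |P₂|))
          + |z₀| * ((4 * u + 3 * u ^ 2 + u ^ 3) * (|P₁| + |P₂|))
          + u * (|z₀| * ((1 + u) * (|P₁| + |P₂|))) := by
          refine add_le_add (add_le_add ?_ ?_) ?_
          · exact mul_le_mul h₀ hm_abs (abs_nonneg _) (by positivity)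
          · exact mul_le_mul_of_nonneg_left hmM hz0
          · exact hQ'.trans (mul_le_mul_of_nonneg_left (mul_le_mul_of_nonneg_left hM_abs hz0) hu)
      _ = (6 * u + 7 * u ^ 2 + 4 * u ^ 3 + u ^ 4) * (|z₀| * (|P₁| + |P₂|)) := by ring
  · calc |Q| ≤ |z₀ * M| + u * |z₀ * M| := by
          have h1 := abs_sub_abs_le_abs_sub Q (z₀ * M)
          rw [abs_sub_comm Q (z₀ * M)] at h1
          linarith
      _ = (1 + u) * (|z₀| * |M|) := by rw [abs_mul]; ring
      _ ≤ (1 + u) * (|z₀| * ((1 + u) * (|P₁| + |P₂|))) :=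
          mul_le_mul_of_nonneg_left (mul_le_mul_of_nonneg_left hM_abs hz0) (by positivity)
      _ = (1 + u) ^ 2 * (|z₀| * (|P₁| + |P₂|)) := by ring

/-- **The margin of Table 3, line A**: for `0 ≤ ε ≤ 1/64`,
`7ε + 9ε² + 5ε³ + ε⁴ ≤ (1 − ε)⁶(7 + 56ε)ε`, because the difference is
`ε²(5 − 236ε + 699ε² − 1015ε³ + 798ε⁴ − 329ε⁵ + 56ε⁶)` and `5 − 236ε ≥ 5 − 236/64 > 0`,
`699ε² ≥ 1015ε³`, `798ε⁴ ≥ 329ε⁵`.  (At `ε = 1/32` the margin is already negative, `≈ −1.72ε²`: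
the coefficient `7ε + 56ε²` is tailored to IEEE precisions.)
[cite: Shewchuk1997, §4.4 Table 3 p. 351] -/
theorem o3derrboundA_margin {u : ℚ} (hu0 : 0 ≤ u) (hu : u ≤ 1 / 64) :
    7 * u + 9 * u ^ 2 + 5 * u ^ 3 + u ^ 4 ≤ (1 - u) ^ 6 * ((7 + 56 * u) * u) := by
  have hkey : (1 - u) ^ 6 * ((7 + 56 * u) * u) - (7 * u + 9 * u ^ 2 + 5 * u ^ 3 + u ^ 4) =
      u ^ 2 * (5 - 236 * u + 699 * u ^ 2 - 1015 * u ^ 3 + 798 * u ^ 4 - 329 * u ^ 5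
        + 56 * u ^ 6) := by
    ring
  have h1 : 0 ≤ 5 - 236 * u := by linarith
  have h2 : 0 ≤ 699 * u ^ 2 - 1015 * u ^ 3 := by
    have h : 0 ≤ 699 - 1015 * u := by linarith
    have := mul_nonneg (pow_nonneg hu0 2) h
    linarith
  have h3 : 0 ≤ 798 * u ^ 4 - 329 * u ^ 5 := by
    have h : 0 ≤ 798 - 329 * u := by linarith
    have := mul_nonneg (pow_nonneg hu0 4) h
    linarith
  have h4 : 0 ≤ 56 * u ^ 6 := by positivity
  have hpoly : 0 ≤ 5 - 236 * u + 699 * u ^ 2 - 1015 * u ^ 3 + 798 * u ^ 4 - 329 * u ^ 5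
      + 56 * u ^ 6 := by linarith
  have := mul_nonneg (pow_nonneg hu0 2) hpoly
  rw [← hkey] at this
  linarith

/-- **The sign test of ORIENT3D's stage A is sound** (Table 3, line A), as an inequality between
rationals.  Let `0 < ε ≤ 1/64` and `K ≥ (7 + 56ε)ε`.  The nine differences and six products carry
relative errors `ε` w.r.t. their COMPUTED values (`t = x ± ε|x|`, `x·x' = P ± ε|P|`), the three
minors `M = fl(P − P')`, the three cofactor terms `Q = fl(x_z·M)` and the first addition
`R = fl(Q_a + Q_b)` relative errors `ε` w.r.t. the true operands, the last addition
`det = fl(R + Q_c)` w.r.t. the computed value; the bound is evaluated as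
`A_a = fl(|P₁| + |P₂|)`, `α_a = fl(A_a|x_{a,z}|)` (likewise `b`, `c`), `W₁ = fl(α_a + α_b)`,
`W = fl(W₁ + α_c)`, `E = fl(KW)`, each with relative error `ε`.  If the test `E < |det|` passes,
then `det` has the sign of the exact determinant (7) (strictly, both ways).  Proof:
`|(7) − det| ≤ ε|det| + (7ε + 9ε² + 5ε³ + ε⁴)Π` (`cofactor_sub_le_of_rel` thrice, `Π` the exact
permanent of the computed products), `E ≥ (1 − ε)⁵KΠ`, and `o3derrboundA_margin`.
[cite: Shewchuk1997, §4.4 Table 3 p. 351 (line A), Fig. 22; §4.3 p. 348 (method)] -/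
theorem orient3d_stageA_sign_of_bounds
    {u K ta₁ ta₂ ta₃ tb₁ tb₂ tb₃ tc₁ tc₂ tc₃ xa₁ xa₂ xa₃ xb₁ xb₂ xb₃ xc₁ xc₂ xc₃
      P₁ P₂ P₃ P₄ P₅ P₆ Ma Mb Mc Qa Qb Qc R det Aa Ab Ac αa αb αc W₁ W E : ℚ}
    (hu0 : 0 < u) (hu : u ≤ 1 / 64) (hK : (7 + 56 * u) * u ≤ K)
    (ha₁ : |ta₁ - xa₁| ≤ u * |xa₁|) (ha₂ : |ta₂ - xa₂| ≤ u * |xa₂|)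
    (ha₃ : |ta₃ - xa₃| ≤ u * |xa₃|) (hb₁ : |tb₁ - xb₁| ≤ u * |xb₁|)
    (hb₂ : |tb₂ - xb₂| ≤ u * |xb₂|) (hb₃ : |tb₃ - xb₃| ≤ u * |xb₃|)
    (hc₁ : |tc₁ - xc₁| ≤ u * |xc₁|) (hc₂ : |tc₂ - xc₂| ≤ u * |xc₂|)
    (hc₃ : |tc₃ - xc₃| ≤ u * |xc₃|)
    (hP₁ : |xb₁ * xc₂ - P₁| ≤ u * |P₁|) (hP₂ : |xc₁ * xb₂ - P₂| ≤ u * |P₂|)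
    (hP₃ : |xc₁ * xa₂ - P₃| ≤ u * |P₃|) (hP₄ : |xa₁ * xc₂ - P₄| ≤ u * |P₄|)
    (hP₅ : |xa₁ * xb₂ - P₅| ≤ u * |P₅|) (hP₆ : |xb₁ * xa₂ - P₆| ≤ u * |P₆|)
    (hMa : |(P₁ - P₂) - Ma| ≤ u * |P₁ - P₂|) (hMb : |(P₃ - P₄) - Mb| ≤ u * |P₃ - P₄|)
    (hMc : |(P₅ - P₆) - Mc| ≤ u * |P₅ - P₆|)
    (hQa : |xa₃ * Ma - Qa| ≤ u * |xa₃ * Ma|) (hQb : |xb₃ * Mb - Qb| ≤ u * |xb₃ * Mb|)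
    (hQc : |xc₃ * Mc - Qc| ≤ u * |xc₃ * Mc|)
    (hR : |(Qa + Qb) - R| ≤ u * |Qa + Qb|) (hdet : |(R + Qc) - det| ≤ u * |det|)
    (hAa : |(|P₁| + |P₂|) - Aa| ≤ u * |(|P₁| + |P₂|)|)
    (hAb : |(|P₃| + |P₄|) - Ab| ≤ u * |(|P₃| + |P₄|)|)
    (hAc : |(|P₅| + |P₆|) - Ac| ≤ u * |(|P₅| + |P₆|)|)
    (hαa : |(Aa * |xa₃|) - αa| ≤ u * |(Aa * |xa₃|)|)
    (hαb : |(Ab * |xb₃|) - αb| ≤ u * |(Ab * |xb₃|)|)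
    (hαc : |(Ac * |xc₃|) - αc| ≤ u * |(Ac * |xc₃|)|)
    (hW₁ : |(αa + αb) - W₁| ≤ u * |αa + αb|) (hW : |(W₁ + αc) - W| ≤ u * |W₁ + αc|)
    (hE : |K * W - E| ≤ u * |K * W|) (htest : E < |det|) :
    (0 < det ↔ 0 < ta₃ * (tb₁ * tc₂ - tc₁ * tb₂) + tb₃ * (tc₁ * ta₂ - ta₁ * tc₂)
        + tc₃ * (ta₁ * tb₂ - tb₁ * ta₂)) ∧
      (det < 0 ↔ ta₃ * (tb₁ * tc₂ - tc₁ * tb₂) + tb₃ * (tc₁ * ta₂ - ta₁ * tc₂)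
        + tc₃ * (ta₁ * tb₂ - tb₁ * ta₂) < 0) := by
  -- the three cofactor terms
  obtain ⟨ea, qa⟩ := cofactor_sub_le_of_rel hu0.le ha₃ hb₁ hc₂ hc₁ hb₂ hP₁ hP₂ hMa hQa
  obtain ⟨eb, qb⟩ := cofactor_sub_le_of_rel hu0.le hb₃ hc₁ ha₂ ha₁ hc₂ hP₃ hP₄ hMb hQb
  obtain ⟨ec, qc⟩ := cofactor_sub_le_of_rel hu0.le hc₃ ha₁ hb₂ hb₁ ha₂ hP₅ hP₆ hMc hQc
  set D := ta₃ * (tb₁ * tc₂ - tc₁ * tb₂) + tb₃ * (tc₁ * ta₂ - ta₁ * tc₂)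
    + tc₃ * (ta₁ * tb₂ - tb₁ * ta₂) with hD
  set g := 6 * u + 7 * u ^ 2 + 4 * u ^ 3 + u ^ 4 with hg
  set Sa := |P₁| + |P₂| with hSa
  set Sb := |P₃| + |P₄| with hSb
  set Sc := |P₅| + |P₆| with hSc
  have hSa0 : 0 ≤ Sa := by rw [hSa]; positivity
  have hSb0 : 0 ≤ Sb := by rw [hSb]; positivity
  have hSc0 : 0 ≤ Sc := by rw [hSc]; positivity
  have hπa0 : 0 ≤ |xa₃| * Sa := mul_nonneg (abs_nonneg _) hSa0
  have hπb0 : 0 ≤ |xb₃| * Sb := mul_nonneg (abs_nonneg _) hSb0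
  have hπc0 : 0 ≤ |xc₃| * Sc := mul_nonneg (abs_nonneg _) hSc0
  have h1u : 0 ≤ 1 - u := by linarith
  have h1u' : 0 < 1 - u := by linarith
  have hK0 : 0 ≤ K := le_trans (by positivity) hK
  -- the total error `|D − det| ≤ (g + ε(1+ε)²)Π + ε|det|`
  have hR' : |(Qa + Qb) - R| ≤ u * (1 + u) ^ 2 * (|xa₃| * Sa + |xb₃| * Sb) := by
    calc |(Qa + Qb) - R| ≤ u * |Qa + Qb| := hR
      _ ≤ u * (|Qa| + |Qb|) := mul_le_mul_of_nonneg_left (abs_add_le _ _) hu0.le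
      _ ≤ u * ((1 + u) ^ 2 * (|xa₃| * Sa) + (1 + u) ^ 2 * (|xb₃| * Sb)) :=
          mul_le_mul_of_nonneg_left (add_le_add qa qb) hu0.le
      _ = u * (1 + u) ^ 2 * (|xa₃| * Sa + |xb₃| * Sb) := by ring
  have herr : |D - det| ≤ (g + u * (1 + u) ^ 2) * (|xa₃| * Sa + |xb₃| * Sb + |xc₃| * Sc)
      + u * |det| := by
    have hdec : D - det = ((ta₃ * (tb₁ * tc₂ - tc₁ * tb₂) - Qa)
        + (tb₃ * (tc₁ * ta₂ - ta₁ * tc₂) - Qb) + (tc₃ * (ta₁ * tb₂ - tb₁ * ta₂) - Qc))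
        + (((Qa + Qb) - R) + ((R + Qc) - det)) := by
      rw [hD]; ring
    rw [hdec]
    have h3 := abs_add_three (ta₃ * (tb₁ * tc₂ - tc₁ * tb₂) - Qa)
      (tb₃ * (tc₁ * ta₂ - ta₁ * tc₂) - Qb) (tc₃ * (ta₁ * tb₂ - tb₁ * ta₂) - Qc)
    have h2 := abs_add_le ((Qa + Qb) - R) ((R + Qc) - det)
    have h1 := abs_add_le ((ta₃ * (tb₁ * tc₂ - tc₁ * tb₂) - Qa)
      + (tb₃ * (tc₁ * ta₂ - ta₁ * tc₂) - Qb) + (tc₃ * (ta₁ * tb₂ - tb₁ * ta₂) - Qc))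
      (((Qa + Qb) - R) + ((R + Qc) - det))
    have hu3 : u * (1 + u) ^ 2 * (|xa₃| * Sa + |xb₃| * Sb)
        ≤ u * (1 + u) ^ 2 * (|xa₃| * Sa + |xb₃| * Sb + |xc₃| * Sc) :=
      mul_le_mul_of_nonneg_left (by linarith) (by positivity)
    have hsum : g * (|xa₃| * Sa) + g * (|xb₃| * Sb) + g * (|xc₃| * Sc)
        + u * (1 + u) ^ 2 * (|xa₃| * Sa + |xb₃| * Sb + |xc₃| * Sc)
        = (g + u * (1 + u) ^ 2) * (|xa₃| * Sa + |xb₃| * Sb + |xc₃| * Sc) := by ring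
    linarith
  -- the computed bound: `E ≥ (1 − ε)⁵ K Π`
  have hAa1 : (1 - u) * Sa ≤ Aa := by
    have h := (abs_sub_le_iff.mp hAa).1
    rw [abs_of_nonneg hSa0] at h
    linarith
  have hAb1 : (1 - u) * Sb ≤ Ab := by
    have h := (abs_sub_le_iff.mp hAb).1
    rw [abs_of_nonneg hSb0] at h
    linarith
  have hAc1 : (1 - u) * Sc ≤ Ac := by
    have h := (abs_sub_le_iff.mp hAc).1
    rw [abs_of_nonneg hSc0] at h
    linarith
  have hAa0 : 0 ≤ Aa := le_trans (mul_nonneg h1u hSa0) hAa1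
  have hAb0 : 0 ≤ Ab := le_trans (mul_nonneg h1u hSb0) hAb1
  have hAc0 : 0 ≤ Ac := le_trans (mul_nonneg h1u hSc0) hAc1
  have hαa1 : (1 - u) ^ 2 * (|xa₃| * Sa) ≤ αa := by
    have h := (abs_sub_le_iff.mp hαa).1
    rw [abs_of_nonneg (mul_nonneg hAa0 (abs_nonneg xa₃))] at h
    calc (1 - u) ^ 2 * (|xa₃| * Sa) = (1 - u) * |xa₃| * ((1 - u) * Sa) := by ring
      _ ≤ (1 - u) * |xa₃| * Aa := mul_le_mul_of_nonneg_left hAa1 (mul_nonneg h1u (abs_nonneg _))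
      _ = (1 - u) * (Aa * |xa₃|) := by ring
      _ ≤ αa := by linarith
  have hαb1 : (1 - u) ^ 2 * (|xb₃| * Sb) ≤ αb := by
    have h := (abs_sub_le_iff.mp hαb).1
    rw [abs_of_nonneg (mul_nonneg hAb0 (abs_nonneg xb₃))] at h
    calc (1 - u) ^ 2 * (|xb₃| * Sb) = (1 - u) * |xb₃| * ((1 - u) * Sb) := by ring
      _ ≤ (1 - u) * |xb₃| * Ab := mul_le_mul_of_nonneg_left hAb1 (mul_nonneg h1u (abs_nonneg _))
      _ = (1 - u) * (Ab * |xb₃|) := by ring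
      _ ≤ αb := by linarith
  have hαc1 : (1 - u) ^ 2 * (|xc₃| * Sc) ≤ αc := by
    have h := (abs_sub_le_iff.mp hαc).1
    rw [abs_of_nonneg (mul_nonneg hAc0 (abs_nonneg xc₃))] at h
    calc (1 - u) ^ 2 * (|xc₃| * Sc) = (1 - u) * |xc₃| * ((1 - u) * Sc) := by ring
      _ ≤ (1 - u) * |xc₃| * Ac := mul_le_mul_of_nonneg_left hAc1 (mul_nonneg h1u (abs_nonneg _))
      _ = (1 - u) * (Ac * |xc₃|) := by ring
      _ ≤ αc := by linarith
  have h1u2 : 0 ≤ (1 - u) ^ 2 := pow_nonneg h1u 2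
  have hαa0 : 0 ≤ αa := le_trans (mul_nonneg h1u2 hπa0) hαa1
  have hαb0 : 0 ≤ αb := le_trans (mul_nonneg h1u2 hπb0) hαb1
  have hαc0 : 0 ≤ αc := le_trans (mul_nonneg h1u2 hπc0) hαc1
  have hW₁1 : (1 - u) * (αa + αb) ≤ W₁ := by
    have h := (abs_sub_le_iff.mp hW₁).1
    rw [abs_of_nonneg (add_nonneg hαa0 hαb0)] at h
    linarith
  have hW₁0 : 0 ≤ W₁ := le_trans (mul_nonneg h1u (add_nonneg hαa0 hαb0)) hW₁1
  have hW1 : (1 - u) * (W₁ + αc) ≤ W := by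
    have h := (abs_sub_le_iff.mp hW).1
    rw [abs_of_nonneg (add_nonneg hW₁0 hαc0)] at h
    linarith
  have hW0 : 0 ≤ W := le_trans (mul_nonneg h1u (add_nonneg hW₁0 hαc0)) hW1
  have hW2 : (1 - u) ^ 4 * (|xa₃| * Sa + |xb₃| * Sb + |xc₃| * Sc) ≤ W := by
    have h1 : (1 - u) * ((1 - u) * (αa + αb) + αc) ≤ (1 - u) * (W₁ + αc) :=
      mul_le_mul_of_nonneg_left (by linarith) h1u
    have h2 : (1 - u) ^ 2 * αc ≤ (1 - u) * αc := by
      have h : (1 - u) ^ 2 ≤ 1 - u := by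
        have : (1 - u) ^ 2 = (1 - u) - u * (1 - u) := by ring
        rw [this]
        linarith [mul_nonneg hu0.le h1u]
      exact mul_le_mul_of_nonneg_right h hαc0
    have h3 : (1 - u) * ((1 - u) * (αa + αb) + αc) = (1 - u) ^ 2 * (αa + αb) + (1 - u) * αc := by
      ring
    have h4 : (1 - u) ^ 4 * (|xa₃| * Sa + |xb₃| * Sb + |xc₃| * Sc)
        = (1 - u) ^ 2 * ((1 - u) ^ 2 * (|xa₃| * Sa) + (1 - u) ^ 2 * (|xb₃| * Sb)
          + (1 - u) ^ 2 * (|xc₃| * Sc)) := by ring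
    have h5 : (1 - u) ^ 2 * ((1 - u) ^ 2 * (|xa₃| * Sa) + (1 - u) ^ 2 * (|xb₃| * Sb)
          + (1 - u) ^ 2 * (|xc₃| * Sc)) ≤ (1 - u) ^ 2 * (αa + αb + αc) :=
      mul_le_mul_of_nonneg_left (by linarith) h1u2
    have h6 : (1 - u) ^ 2 * (αa + αb + αc) = (1 - u) ^ 2 * (αa + αb) + (1 - u) ^ 2 * αc := by
      ring
    linarith
  have hE1 : (1 - u) * (K * W) ≤ E := by
    have h := (abs_sub_le_iff.mp hE).1
    rw [abs_of_nonneg (mul_nonneg hK0 hW0)] at h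
    linarith
  have hE2 : (1 - u) ^ 5 * K * (|xa₃| * Sa + |xb₃| * Sb + |xc₃| * Sc) ≤ E := by
    calc (1 - u) ^ 5 * K * (|xa₃| * Sa + |xb₃| * Sb + |xc₃| * Sc)
          = (1 - u) * (K * ((1 - u) ^ 4 * (|xa₃| * Sa + |xb₃| * Sb + |xc₃| * Sc))) := by ring
      _ ≤ (1 - u) * (K * W) := mul_le_mul_of_nonneg_left (mul_le_mul_of_nonneg_left hW2 hK0) h1u
      _ ≤ E := hE1
  -- the margin
  have hPi0 : 0 ≤ |xa₃| * Sa + |xb₃| * Sb + |xc₃| * Sc := by linarith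
  have hG : (g + u * (1 + u) ^ 2) * (|xa₃| * Sa + |xb₃| * Sb + |xc₃| * Sc)
      ≤ (1 - u) ^ 6 * K * (|xa₃| * Sa + |xb₃| * Sb + |xc₃| * Sc) := by
    have hm := o3derrboundA_margin hu0.le hu
    have h1 : (1 - u) ^ 6 * ((7 + 56 * u) * u) ≤ (1 - u) ^ 6 * K :=
      mul_le_mul_of_nonneg_left hK (pow_nonneg h1u 6)
    have h2 : g + u * (1 + u) ^ 2 = 7 * u + 9 * u ^ 2 + 5 * u ^ 3 + u ^ 4 := by rw [hg]; ring
    rw [h2]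
    exact mul_le_mul_of_nonneg_right (hm.trans h1) hPi0
  have hmargin : (g + u * (1 + u) ^ 2) * (|xa₃| * Sa + |xb₃| * Sb + |xc₃| * Sc)
      < (1 - u) * |det| := by
    calc (g + u * (1 + u) ^ 2) * (|xa₃| * Sa + |xb₃| * Sb + |xc₃| * Sc)
          ≤ (1 - u) ^ 6 * K * (|xa₃| * Sa + |xb₃| * Sb + |xc₃| * Sc) := hG
      _ = (1 - u) * ((1 - u) ^ 5 * K * (|xa₃| * Sa + |xb₃| * Sb + |xc₃| * Sc)) := by ring
      _ ≤ (1 - u) * E := mul_le_mul_of_nonneg_left hE2 h1u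
      _ < (1 - u) * |det| := mul_lt_mul_of_pos_left htest h1u'
  have hstrict : |D - det| < |det| := by linarith
  -- sign conclusions
  obtain ⟨hl, hr⟩ := abs_sub_lt_iff.mp hstrict
  constructor
  · constructor
    · intro hpos
      rw [abs_of_pos hpos] at hr
      linarith
    · intro hDpos
      by_contra hle
      push Not at hle
      rcases hle.lt_or_eq with hneg | hzero
      · rw [abs_of_neg hneg] at hl
        linarith
      · rw [hzero, abs_zero] at hstrict
        exact absurd hstrict (not_lt.mpr (abs_nonneg _))
  · constructor
    · intro hneg
      rw [abs_of_neg hneg] at hl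
      linarith
    · intro hDneg
      by_contra hle
      push Not at hle
      rcases hle.lt_or_eq with hpos | hzero
      · rw [abs_of_pos hpos] at hr
        linarith
      · rw [← hzero, abs_zero] at hstrict
        exact absurd hstrict (not_lt.mpr (abs_nonneg _))


/-! ## Stage A of ORIENT3D -/

/-- The coefficient `o3derrboundA = (7 + 56ε)ε` of Table 3, line A (`ε = 2^−p`; `predicates.c`
`exactinit`: `o3derrboundA = (7.0 + 56.0 * epsilon) * epsilon`, computed exactly).
[cite: Shewchuk1997, §4.4 Table 3 p. 351] -/
def o3derrboundA (p : ℕ) : ℚ := (7 + 56 * unitRoundoff p) * unitRoundoff p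

/-- `o3derrboundA = (7·2^p + 56)·2^(−2p)` lies on the grid `2^(−2p) ℤ`.
[cite: Shewchuk1997, §4.4 Table 3 p. 351] -/
theorem onGrid_o3derrboundA (p : ℕ) : OnGrid (-(2 * (p : ℤ))) (o3derrboundA p) := by
  refine ⟨7 * 2 ^ p + 56, ?_⟩
  unfold o3derrboundA unitRoundoff
  have h2 : (2 : ℚ) ^ p ≠ 0 := pow_ne_zero _ (by norm_num)
  rw [show (-(2 * (p : ℤ))) = -((p : ℤ) + (p : ℤ)) by ring, zpow_neg, zpow_add₀ (by norm_num),
    zpow_natCast]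
  push_cast
  field_simp

/-- The exact determinant (7) of ORIENT3D, expanded along its third column as in Fig. 22 and
`predicates.c`: `(a_z−d_z)((b_x−d_x)(c_y−d_y) − (c_x−d_x)(b_y−d_y)) + (b_z−d_z)((c_x−d_x)(a_y−d_y)
− (a_x−d_x)(c_y−d_y)) + (c_z−d_z)((a_x−d_x)(b_y−d_y) − (b_x−d_x)(a_y−d_y))`; positive iff `d` lies
below the oriented plane `abc` (§4.2 p. 344).
[cite: Shewchuk1997, §4.2 eq. (7) p. 345; Fig. 22 p. 351] -/
def orient3dDet (a₁ a₂ a₃ b₁ b₂ b₃ c₁ c₂ c₃ d₁ d₂ d₃ : ℚ) : ℚ :=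
  (a₃ - d₃) * ((b₁ - d₁) * (c₂ - d₂) - (c₁ - d₁) * (b₂ - d₂))
    + (b₃ - d₃) * ((c₁ - d₁) * (a₂ - d₂) - (a₁ - d₁) * (c₂ - d₂))
    + (c₃ - d₃) * ((a₁ - d₁) * (b₂ - d₂) - (b₁ - d₁) * (a₂ - d₂))

/-- `orient3dDet` is the `3 × 3` determinant (7) (cofactor expansion along the first row).
[cite: Shewchuk1997, §4.2 eq. (7) p. 345] -/
theorem orient3dDet_eq_det (a₁ a₂ a₃ b₁ b₂ b₃ c₁ c₂ c₃ d₁ d₂ d₃ : ℚ) :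
    orient3dDet a₁ a₂ a₃ b₁ b₂ b₃ c₁ c₂ c₃ d₁ d₂ d₃ =
      (a₁ - d₁) * ((b₂ - d₂) * (c₃ - d₃) - (b₃ - d₃) * (c₂ - d₂))
        - (a₂ - d₂) * ((b₁ - d₁) * (c₃ - d₃) - (b₃ - d₃) * (c₁ - d₁))
        + (a₃ - d₃) * ((b₁ - d₁) * (c₂ - d₂) - (b₂ - d₂) * (c₁ - d₁)) := by
  unfold orient3dDet; ring

/-- **Stage A of ORIENT3D** (Fig. 22, approximation A; `predicates.c` function `orient3d`), over a
rounding `fl` and a bound coefficient `K`: the nine differences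
`adx = a_x ⊖ d_x, …, cdz = c_z ⊖ d_z`, the six products
`bdxcdy = bdx ⊗ cdy, cdxbdy, cdxady, adxcdy, adxbdy, bdxady`,
`det ⇐ adz ⊗ (bdxcdy ⊖ cdxbdy) ⊕ bdz ⊗ (cdxady ⊖ adxcdy) ⊕ cdz ⊗ (adxbdy ⊖ bdxady)`,
`permanent ⇐ (|bdxcdy| ⊕ |cdxbdy|) ⊗ |adz| ⊕ (|cdxady| ⊕ |adxcdy|) ⊗ |bdz|
⊕ (|adxbdy| ⊕ |bdxady|) ⊗ |cdz|` (both three-term sums left to right),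
`errbound ⇐ K ⊗ permanent`; return `det` iff `det > errbound` or `−det > errbound`.  `some det` =
stage A answers; `none` = fall through to `orient3dadapt`.
[cite: Shewchuk1997, §4.4 Fig. 22 and Table 3 p. 351] -/
def orient3dStageA (fl : ℚ → ℚ) (K : ℚ) (a₁ a₂ a₃ b₁ b₂ b₃ c₁ c₂ c₃ d₁ d₂ d₃ : ℚ) : Option ℚ :=
  let adx := fl (a₁ - d₁)
  let bdx := fl (b₁ - d₁)
  let cdx := fl (c₁ - d₁)
  let ady := fl (a₂ - d₂)
  let bdy := fl (b₂ - d₂)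
  let cdy := fl (c₂ - d₂)
  let adz := fl (a₃ - d₃)
  let bdz := fl (b₃ - d₃)
  let cdz := fl (c₃ - d₃)
  let bdxcdy := fl (bdx * cdy)
  let cdxbdy := fl (cdx * bdy)
  let cdxady := fl (cdx * ady)
  let adxcdy := fl (adx * cdy)
  let adxbdy := fl (adx * bdy)
  let bdxady := fl (bdx * ady)
  let det := fl (fl (fl (adz * fl (bdxcdy - cdxbdy)) + fl (bdz * fl (cdxady - adxcdy)))
    + fl (cdz * fl (adxbdy - bdxady)))
  let permanent := fl (fl (fl (fl (|bdxcdy| + |cdxbdy|) * |adz|)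
    + fl (fl (|cdxady| + |adxcdy|) * |bdz|)) + fl (fl (|adxbdy| + |bdxady|) * |cdz|))
  let errbound := fl (K * permanent)
  if errbound < det ∨ errbound < -det then some det else none

/-- **THE STAGE-A FILTER OF ORIENT3D IS CORRECT** (Table 3, line A).  Let `p ≥ 6`, `fl` ANY
round-to-nearest into `F(p, emin)` (any tie-breaking rule), `K = o3derrboundA p = (7 + 56ε)ε`, and
the twelve coordinates floats of a format `F(p, e₀)` with `emin ≤ e₀` and `emin + 2p ≤ 3e₀` (so
that every operation of stage A — on the grids `2^e₀ ℤ`, `2^2e₀ ℤ`, `2^3e₀ ℤ`, `2^(3e₀ − 2p) ℤ` —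
is exact or rounds a normal number).  If stage A returns `det`, then `det > 0 ↔ (7) > 0` and
`det < 0 ↔ (7) < 0` for the exact determinant `orient3dDet`; in particular `det ≠ 0` and the
returned sign is the true orientation.
[cite: Shewchuk1997, §4.4 Table 3 p. 351 (line A), Fig. 22] -/
theorem orient3dStageA_correct (hp : 6 ≤ p) (hfl : IsRoundNearest p emin fl) {e₀ : ℤ}
    (he₀ : emin ≤ e₀) (h3 : emin + 2 * p ≤ e₀ + e₀ + e₀)
    {a₁ a₂ a₃ b₁ b₂ b₃ c₁ c₂ c₃ d₁ d₂ d₃ : ℚ}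
    (ha₁ : IsFloat p e₀ a₁) (ha₂ : IsFloat p e₀ a₂) (ha₃ : IsFloat p e₀ a₃)
    (hb₁ : IsFloat p e₀ b₁) (hb₂ : IsFloat p e₀ b₂) (hb₃ : IsFloat p e₀ b₃)
    (hc₁ : IsFloat p e₀ c₁) (hc₂ : IsFloat p e₀ c₂) (hc₃ : IsFloat p e₀ c₃)
    (hd₁ : IsFloat p e₀ d₁) (hd₂ : IsFloat p e₀ d₂) (hd₃ : IsFloat p e₀ d₃) {A : ℚ}
    (hA : orient3dStageA fl (o3derrboundA p) a₁ a₂ a₃ b₁ b₂ b₃ c₁ c₂ c₃ d₁ d₂ d₃ = some A) :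
    (0 < A ↔ 0 < orient3dDet a₁ a₂ a₃ b₁ b₂ b₃ c₁ c₂ c₃ d₁ d₂ d₃) ∧
      (A < 0 ↔ orient3dDet a₁ a₂ a₃ b₁ b₂ b₃ c₁ c₂ c₃ d₁ d₂ d₃ < 0) := by
  have hp1 : 1 ≤ p := le_trans (by norm_num) hp
  have he₂ : emin ≤ e₀ + e₀ := by omega
  have he₃ : emin ≤ e₀ + e₀ + e₀ := by omega
  have he₃' : emin ≤ e₀ + (e₀ + e₀) := by omega
  have he₄ : emin ≤ -(2 * (p : ℤ)) + (e₀ + e₀ + e₀) := by omega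
  have hu0 : 0 < unitRoundoff p := by unfold unitRoundoff; positivity
  have hu64 : unitRoundoff p ≤ 1 / 64 := unitRoundoff_le_of_six_le hp
  have hK : (7 + 56 * unitRoundoff p) * unitRoundoff p ≤ o3derrboundA p := le_of_eq rfl
  -- grids: the nine differences (`2^e₀ ℤ`) and their roundings
  have gta₁ := (OnGrid.of_isFloat ha₁).sub (OnGrid.of_isFloat hd₁)
  have gta₂ := (OnGrid.of_isFloat ha₂).sub (OnGrid.of_isFloat hd₂)
  have gta₃ := (OnGrid.of_isFloat ha₃).sub (OnGrid.of_isFloat hd₃)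
  have gtb₁ := (OnGrid.of_isFloat hb₁).sub (OnGrid.of_isFloat hd₁)
  have gtb₂ := (OnGrid.of_isFloat hb₂).sub (OnGrid.of_isFloat hd₂)
  have gtb₃ := (OnGrid.of_isFloat hb₃).sub (OnGrid.of_isFloat hd₃)
  have gtc₁ := (OnGrid.of_isFloat hc₁).sub (OnGrid.of_isFloat hd₁)
  have gtc₂ := (OnGrid.of_isFloat hc₂).sub (OnGrid.of_isFloat hd₂)
  have gtc₃ := (OnGrid.of_isFloat hc₃).sub (OnGrid.of_isFloat hd₃)
  have gxa₁ := gta₁.fl_of hp1 hfl he₀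
  have gxa₂ := gta₂.fl_of hp1 hfl he₀
  have gxa₃ := gta₃.fl_of hp1 hfl he₀
  have gxb₁ := gtb₁.fl_of hp1 hfl he₀
  have gxb₂ := gtb₂.fl_of hp1 hfl he₀
  have gxb₃ := gtb₃.fl_of hp1 hfl he₀
  have gxc₁ := gtc₁.fl_of hp1 hfl he₀
  have gxc₂ := gtc₂.fl_of hp1 hfl he₀
  have gxc₃ := gtc₃.fl_of hp1 hfl he₀
  -- the six products and their roundings (`2^2e₀ ℤ`)
  have gp₁ := gxb₁.mul gxc₂
  have gp₂ := gxc₁.mul gxb₂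
  have gp₃ := gxc₁.mul gxa₂
  have gp₄ := gxa₁.mul gxc₂
  have gp₅ := gxa₁.mul gxb₂
  have gp₆ := gxb₁.mul gxa₂
  have gP₁ := gp₁.fl_of hp1 hfl he₂
  have gP₂ := gp₂.fl_of hp1 hfl he₂
  have gP₃ := gp₃.fl_of hp1 hfl he₂
  have gP₄ := gp₄.fl_of hp1 hfl he₂
  have gP₅ := gp₅.fl_of hp1 hfl he₂
  have gP₆ := gp₆.fl_of hp1 hfl he₂
  -- minors (`2^2e₀ ℤ`), cofactor terms and the two additions (`2^3e₀ ℤ`)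
  have gma := gP₁.sub gP₂
  have gmb := gP₃.sub gP₄
  have gmc := gP₅.sub gP₆
  have gMa := gma.fl_of hp1 hfl he₂
  have gMb := gmb.fl_of hp1 hfl he₂
  have gMc := gmc.fl_of hp1 hfl he₂
  have gqa := gxa₃.mul gMa
  have gqb := gxb₃.mul gMb
  have gqc := gxc₃.mul gMc
  have gQa := gqa.fl_of hp1 hfl he₃'
  have gQb := gqb.fl_of hp1 hfl he₃'
  have gQc := gqc.fl_of hp1 hfl he₃'
  have gr := gQa.add gQb
  have gR := gr.fl_of hp1 hfl he₃'
  have gd := gR.add gQc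
  -- the bound: `A_a = fl(|P₁| + |P₂|)` (`2^2e₀ ℤ`), `α_a = fl(A_a |adz|)`, `W₁`, `W` (`2^3e₀ ℤ`),
  -- `errbound = fl(K W)` (`2^(3e₀ − 2p) ℤ`)
  have gsa := gP₁.abs.add gP₂.abs
  have gsb := gP₃.abs.add gP₄.abs
  have gsc := gP₅.abs.add gP₆.abs
  have gAa := gsa.fl_of hp1 hfl he₂
  have gAb := gsb.fl_of hp1 hfl he₂
  have gAc := gsc.fl_of hp1 hfl he₂
  have gala := gAa.mul gxa₃.abs
  have galb := gAb.mul gxb₃.abs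
  have galc := gAc.mul gxc₃.abs
  have gαa := gala.fl_of hp1 hfl he₃
  have gαb := galb.fl_of hp1 hfl he₃
  have gαc := galc.fl_of hp1 hfl he₃
  have gw₁ := gαa.add gαb
  have gW₁ := gw₁.fl_of hp1 hfl he₃
  have gw := gW₁.add gαc
  have gW := gw.fl_of hp1 hfl he₃
  have ge := (onGrid_o3derrboundA p).mul gW
  -- the branches of stage A
  unfold orient3dStageA at hA
  simp only [] at hA
  split_ifs at hA with htest
  obtain rfl := Option.some.inj hA
  unfold orient3dDet
  exact orient3d_stageA_sign_of_bounds hu0 hu64 hK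
    (abs_sub_fl_le_eps_mul_abs_fl hp1 hfl he₀ gta₁) (abs_sub_fl_le_eps_mul_abs_fl hp1 hfl he₀ gta₂)
    (abs_sub_fl_le_eps_mul_abs_fl hp1 hfl he₀ gta₃) (abs_sub_fl_le_eps_mul_abs_fl hp1 hfl he₀ gtb₁)
    (abs_sub_fl_le_eps_mul_abs_fl hp1 hfl he₀ gtb₂) (abs_sub_fl_le_eps_mul_abs_fl hp1 hfl he₀ gtb₃)
    (abs_sub_fl_le_eps_mul_abs_fl hp1 hfl he₀ gtc₁) (abs_sub_fl_le_eps_mul_abs_fl hp1 hfl he₀ gtc₂)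
    (abs_sub_fl_le_eps_mul_abs_fl hp1 hfl he₀ gtc₃)
    (abs_sub_fl_le_eps_mul_abs_fl hp1 hfl he₂ gp₁) (abs_sub_fl_le_eps_mul_abs_fl hp1 hfl he₂ gp₂)
    (abs_sub_fl_le_eps_mul_abs_fl hp1 hfl he₂ gp₃) (abs_sub_fl_le_eps_mul_abs_fl hp1 hfl he₂ gp₄)
    (abs_sub_fl_le_eps_mul_abs_fl hp1 hfl he₂ gp₅) (abs_sub_fl_le_eps_mul_abs_fl hp1 hfl he₂ gp₆)
    (abs_sub_fl_le_eps_mul_abs hp1 hfl he₂ gma) (abs_sub_fl_le_eps_mul_abs hp1 hfl he₂ gmb)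
    (abs_sub_fl_le_eps_mul_abs hp1 hfl he₂ gmc)
    (abs_sub_fl_le_eps_mul_abs hp1 hfl he₃' gqa) (abs_sub_fl_le_eps_mul_abs hp1 hfl he₃' gqb)
    (abs_sub_fl_le_eps_mul_abs hp1 hfl he₃' gqc)
    (abs_sub_fl_le_eps_mul_abs hp1 hfl he₃' gr) (abs_sub_fl_le_eps_mul_abs_fl hp1 hfl he₃' gd)
    (abs_sub_fl_le_eps_mul_abs hp1 hfl he₂ gsa) (abs_sub_fl_le_eps_mul_abs hp1 hfl he₂ gsb)
    (abs_sub_fl_le_eps_mul_abs hp1 hfl he₂ gsc)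
    (abs_sub_fl_le_eps_mul_abs hp1 hfl he₃ gala) (abs_sub_fl_le_eps_mul_abs hp1 hfl he₃ galb)
    (abs_sub_fl_le_eps_mul_abs hp1 hfl he₃ galc)
    (abs_sub_fl_le_eps_mul_abs hp1 hfl he₃ gw₁) (abs_sub_fl_le_eps_mul_abs hp1 hfl he₃ gw)
    (abs_sub_fl_le_eps_mul_abs hp1 hfl he₄ ge)
    (htest.elim (fun h => lt_of_lt_of_le h (le_abs_self _))
      (fun h => lt_of_lt_of_le h (neg_le_abs _)))

end Literature.ComputerArithmetic.Shewchuk1997
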